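import Summits.QuantumFields.YangMills.Theorems.UnitScaleTiltProp7AxialGaugeBlock
import Summits.QuantumFields.YangMills.Theorems.UnitScaleTiltProp7AxialGauge
import Literature.MathematicalPhysics.QuantumFieldTheory.Balaban1983to89.T3SectALandauChart
import HarnessLib

/-!
# Route `UnitScaleTilt`, crux K1 child «MinimiserStabilityRegPr» (stmt-QuantumFields-19200), registered stub `stub_prop7From14` (skeleton birth_v7
# cc37a178…; leaf V3 «Prop 7 from a background (14)») — [Balaban1985Variational] SECT. A, THE SPACE (18) AT THE d = 3 CARRIER: every element of the
# regular fibre (6) has a (4)-gauge image in the axial space `𝔘_k(ε₀) ∩ 𝔅_k(V) ∩ Ax_k(𝔅_k, U₀)`, still regular, still in the fibre, still critical (reading R2)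
# when it was, and `O(ε₀η)`-close to the background on the interior bonds of every `(K−n)`-block

Cell `ym3-torus` ∕ fleet seat `ym-ust-19200-p1` (gen 7; HUMAN RULING D-0037, YM ladder rung R3).  The ENTRY POINT of print's chart, p. 280: «The functional
(5) is gauge invariant, hence it is enough to consider it on the space 𝔘_k({Ω_j}, ε₀) ∩ 𝔅_k(𝔅_k, V) ∩ Ax_k(𝔅_k, U₀). (18)» — packaged at the carrier
`T3Thm1Carrier.varProblem3` from this seat's three files (`…Prop7AxialGauge`: the comb axial gauge inside (4), one element per orbit; `…Prop7AxialGaugeSup` ∕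
`…Prop7AxialGaugeBlock`: its `k`-uniform interior sup bound) and the (4)-invariance of print's regular fibre and of criticality in reading R2
(`T3PrintedRegularOrbits.gaugeAct_mem_regFibrePr_iff_of_trivial`, `T3SectALandauChart.isCritR2_gaugeAct_of_trivial`).  The comb gauge is the complete
`n = 0` reading of `Ax_k` ([Balaban1985RegularSpaces] (1.19) is its iterated form).

WHAT IS PROVED (sorry-free, no definition).
* **`exists_axial18`**: for a background `U₀ ∈ 𝔘_k(e₀)` and every `W` in print's regular fibre (6)(ε₀) of `V` there is `v` in the group (4) (`descTransf v = 1`)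
  with `W^v ∈ (6)(ε₀)` (same fibre, same regularity), `W^v` comb-axial relative to `U₀`, `W^v` R2-critical iff `W` is, the (4)-element unique, and
  `‖(W^v)_b U₀,b* − 1‖ ≤ 3(ε₀ + e₀)·L^{−(K−n)}` on every bond with both endpoints in one `(K−n)`-block.
* `atMostOneCriticalOrbit_iff_axial`: clause 1 of the stub (`AtMostOneCriticalOrbit ε₀ V`) may be checked on comb-axial representatives only (print: «it is
  enough to consider it on the space (18)»).

HONEST SCOPE.  Bookkeeping only: the content of Sect. A beyond (18) — [Balaban1985RegularSpaces] Thm 2 (print's Prop. 2), the bonds joining blocks, the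
averaged normalisation (1.29) — is not touched.  Reading R2 of criticality (`T3Thm1CarrierNative.IsCritR2`) as everywhere in the carrier.

References: T. Bałaban, CMP 102 (1985) 277–309 [Balaban1985Variational] ((4), (6) p.278, (15)–(18) p.280); CMP 99 (1985) 75–102 [Balaban1985RegularSpaces]
((1.14) p.78, (1.19) p.79, Lemma 1 (1.25) p.79).
-/

noncomputable section

namespace Summit.QuantumFields.YangMills.Theorems.Prop7AxialSpace18

open scoped Matrix.Norms.L2Operator
open Literature.MathematicalPhysics.QuantumFieldTheory.Balaban1983to89
open T4Continuum
open B10Eq27TorusAxialLog (axialT)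
open B5Eq118OneStroke (iterBlockOf)
open B15DeterminingSets (embIter)
open Literature.MathematicalPhysics.QuantumFieldTheory.Balaban1983to89.T3ContinuumYM3Torus
open Literature.MathematicalPhysics.QuantumFieldTheory.Balaban1983to89.T3PrintedRegularMinimiser (RegPr regFibrePr mem_regFibrePr_iff)
open Literature.MathematicalPhysics.QuantumFieldTheory.Balaban1983to89.T3PrintedRegularOrbits (descTransf gaugeAct_mem_regFibrePr_iff_of_trivial)
open Literature.MathematicalPhysics.QuantumFieldTheory.Balaban1983to89.T3Thm1CarrierNative (IsCritR2)
open Literature.MathematicalPhysics.QuantumFieldTheory.Balaban1983to89.T3Thm1Carrier (varProblem3)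
open Literature.MathematicalPhysics.QuantumFieldTheory.Balaban1983to89.T3SectALandauChart (isCritR2_gaugeAct_of_trivial pos_of_regPr descTransf_inv)
open BlockAveragingEMLLinearisedBackground (pertVar)
open Summit.QuantumFields.YangMills.Theorems.Prop7AxialGauge (exists_axialGauge_T3 existsUnique_axialGauge_T3)
open Summit.QuantumFields.YangMills.Theorems.Prop7AxialGaugeBlock (norm_pertVar_le_interior_T3)

variable (F : T3Family) {n K : ℕ} (h : n ≤ K)

/-- **[Balaban1985Variational] (18) AT THE CARRIER — THE AXIAL SPACE IS REACHED INSIDE (6) BY THE GROUP (4), WITH THE INTERIOR SUP BOUND.**  For a background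
`U₀ ∈ 𝔘_k(e₀)` and `W ∈ 𝔘_k(ε₀) ∩ 𝔅_k(V)` (print's regular fibre (6)): there is `v` with `v↓ = 1` such that `W^v` lies in the same regular fibre, is in the
complete `(K−n)`-fold comb axial gauge relative to `U₀`, is R2-critical iff `W` is, and satisfies `‖(W^v)_bU₀,b* − 1‖ ≤ 3(ε₀ + e₀)L^{−(K−n)}` on every bond
inside a `(K−n)`-block; the element `v` is the only one in (4) gauging `W` axially. [cite: Balaban1985Variational, (18) p.280; Balaban1985RegularSpaces, (1.19) p.79, Lemma 1 (1.25) p.79] -/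
theorem exists_axial18 {ε₀ e₀ : ℝ} (he₀ : 0 ≤ e₀) {V : GaugeField (F.P n) 0 (Matrix.specialUnitaryGroup (Fin 2) ℂ)}
    (U₀ W : GaugeField (F.P K) 0 (Matrix.specialUnitaryGroup (Fin 2) ℂ)) (hU₀ : RegPr F n K e₀ U₀) (hW : W ∈ regFibrePr F n K h ε₀ V) :
    ∃ v : GaugeTransf (F.P K) 0 (Matrix.specialUnitaryGroup (Fin 2) ℂ),
      descTransf F n K h v = (fun _ => 1) ∧
      GaugeField.gaugeAct v W ∈ regFibrePr F n K h ε₀ V ∧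
      (∀ x : Site (F.P K) 0, axialT (GaugeField.gaugeAct v W) (embIter (K - n) (iterBlockOf (K - n) x)) x =
        axialT U₀ (embIter (K - n) (iterBlockOf (K - n) x)) x) ∧
      (IsCritR2 F n K h V (GaugeField.gaugeAct v W) ↔ IsCritR2 F n K h V W) ∧
      (∀ v' : GaugeTransf (F.P K) 0 (Matrix.specialUnitaryGroup (Fin 2) ℂ), descTransf F n K h v' = (fun _ => 1) →
        (∀ x : Site (F.P K) 0, axialT (GaugeField.gaugeAct v' W) (embIter (K - n) (iterBlockOf (K - n) x)) x =
          axialT U₀ (embIter (K - n) (iterBlockOf (K - n) x)) x) → v' = v) ∧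
      ∀ (x : Site (F.P K) 0) (μ : Fin (F.P K).d), iterBlockOf (K - n) (x.shift μ) = iterBlockOf (K - n) x →
        ‖pertVar U₀ (GaugeField.gaugeAct v W) ⟨x, μ⟩‖ ≤ 3 * (ε₀ + e₀) * (((F.L : ℝ))⁻¹) ^ (K - n) := by
  obtain ⟨v, ⟨hv, hax⟩, huniq⟩ := existsUnique_axialGauge_T3 F h U₀ W
  have hε₀ : 0 < ε₀ := pos_of_regPr F ((mem_regFibrePr_iff F).mp hW).2
  have hmem : GaugeField.gaugeAct v W ∈ regFibrePr F n K h ε₀ V := (gaugeAct_mem_regFibrePr_iff_of_trivial F h hε₀.le hv W V).mpr hW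
  refine ⟨v, hv, hmem, hax, ⟨fun hc => ?_, fun hc => isCritR2_gaugeAct_of_trivial F h hv hc⟩, fun v' hv' hax' => huniq v' ⟨hv', hax'⟩, ?_⟩
  · -- back along `v⁻¹`, also in (4)
    have hinv : descTransf F n K h (fun x => (v x)⁻¹) = fun _ => 1 := by
      rw [descTransf_inv, hv]; funext; simp
    have hback : GaugeField.gaugeAct (fun x => (v x)⁻¹) (GaugeField.gaugeAct v W) = W := by
      funext b; simp [GaugeField.gaugeAct, mul_assoc]
    have h' := isCritR2_gaugeAct_of_trivial F h hinv hc
    rwa [hback] at h'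
  · intro x μ hblock
    exact norm_pertVar_le_interior_T3 F n K hε₀.le he₀ (GaugeField.gaugeAct v W) U₀ ((mem_regFibrePr_iff F).mp hmem).2 hU₀ hax x μ hblock

/-- **«IT IS ENOUGH TO CONSIDER IT ON THE SPACE (18)»** for clause 1 of the stub: print's regular fibre has at most one R2-critical (4)-orbit iff any two
COMB-AXIAL (relative to a fixed background `U₀`) R2-critical elements of it lie on one (4)-orbit. [cite: Balaban1985Variational, (18) p.280 («The functional (5) is gauge invariant, hence it is enough to consider it on the space (18)»)] -/
theorem atMostOneCriticalOrbit_iff_axial {ε₀ : ℝ} (V : GaugeField (F.P n) 0 (Matrix.specialUnitaryGroup (Fin 2) ℂ))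
    (U₀ : GaugeField (F.P K) 0 (Matrix.specialUnitaryGroup (Fin 2) ℂ)) :
    (varProblem3 F n K h).AtMostOneCriticalOrbit ε₀ V ↔
      ∀ U U' : GaugeField (F.P K) 0 (Matrix.specialUnitaryGroup (Fin 2) ℂ),
        U ∈ regFibrePr F n K h ε₀ V → IsCritR2 F n K h V U →
        (∀ x, axialT U (embIter (K - n) (iterBlockOf (K - n) x)) x = axialT U₀ (embIter (K - n) (iterBlockOf (K - n) x)) x) →
        U' ∈ regFibrePr F n K h ε₀ V → IsCritR2 F n K h V U' →
        (∀ x, axialT U' (embIter (K - n) (iterBlockOf (K - n) x)) x = axialT U₀ (embIter (K - n) (iterBlockOf (K - n) x)) x) →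
        T3Thm1Carrier.SameOrbit F n K h U U' := by
  constructor
  · intro H U U' hU hc _ hU' hc' _
    exact H U U' ((mem_regFibrePr_iff F).mp hU).2 ((mem_regFibrePr_iff F).mp hU).1 hc
      ((mem_regFibrePr_iff F).mp hU').2 ((mem_regFibrePr_iff F).mp hU').1 hc'
  · intro H U U' hUreg hUfib hc hU'reg hU'fib hc'
    have hU : U ∈ regFibrePr F n K h ε₀ V := (mem_regFibrePr_iff F).mpr ⟨hUfib, hUreg⟩
    have hU' : U' ∈ regFibrePr F n K h ε₀ V := (mem_regFibrePr_iff F).mpr ⟨hU'fib, hU'reg⟩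
    have hε₀ : 0 < ε₀ := pos_of_regPr F hUreg
    obtain ⟨v, hv, hax⟩ := exists_axialGauge_T3 F h U₀ U
    obtain ⟨v', hv', hax'⟩ := exists_axialGauge_T3 F h U₀ U'
    have hmem := (gaugeAct_mem_regFibrePr_iff_of_trivial F h hε₀.le hv U V).mpr hU
    have hmem' := (gaugeAct_mem_regFibrePr_iff_of_trivial F h hε₀.le hv' U' V).mpr hU'
    have hsame := H _ _ hmem (isCritR2_gaugeAct_of_trivial F h hv hc) hax hmem' (isCritR2_gaugeAct_of_trivial F h hv' hc') hax'
    -- `U ~ U^v ~ U'^{v'} ~ U'`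
    exact T3SectALandauChart.sameOrbit_trans F h (T3SectALandauChart.sameOrbit_trans F h ⟨v, hv, rfl⟩ hsame)
      (T3SectALandauChart.sameOrbit_symm F h ⟨v', hv', rfl⟩)

/-! ## §2 (v1.1, append-only) «UNIQUENESS OF CRITICAL CONFIGURATIONS IN THE SPACE (18)»: clause 1 as uniqueness of a POINT -/

open Summit.QuantumFields.YangMills.Theorems.Prop7AxialGauge (eq_one_of_axialGauge)
open B10Eq27TorusAxialLog (gaugeActT_eq_gaugeAct)
open Literature.MathematicalPhysics.QuantumFieldTheory.Balaban1983to89.T3LevelShift (siteShift)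
open Literature.MathematicalPhysics.QuantumFieldTheory.Balaban1983to89.T3PrintedRegularOrbits (sites_eq)

/-- Two comb-axial configurations (relative to the same background) on one (4)-orbit are EQUAL: the (4)-element between them is `1`
(`Prop7AxialGauge.eq_one_of_axialGauge` read through `descTransf = 1`). [cite: Balaban1985RegularSpaces, p.79 (sentence after (1.20))] -/
theorem eq_of_sameOrbit_of_axial (U₀ U U' : GaugeField (F.P K) 0 (Matrix.specialUnitaryGroup (Fin 2) ℂ))
    (hU : ∀ x, axialT U (embIter (K - n) (iterBlockOf (K - n) x)) x = axialT U₀ (embIter (K - n) (iterBlockOf (K - n) x)) x)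
    (hU' : ∀ x, axialT U' (embIter (K - n) (iterBlockOf (K - n) x)) x = axialT U₀ (embIter (K - n) (iterBlockOf (K - n) x)) x)
    (hsame : T3Thm1Carrier.SameOrbit F n K h U U') : U = U' := by
  obtain ⟨w, hw, rfl⟩ := hsame
  have hw' : ∀ y : Site (F.P K) (K - n), w (embIter (K - n) y) = 1 := by
    intro y
    have h1 := congrFun hw ((siteShift (sites_eq F n K h)).symm y)
    unfold descTransf at h1
    rwa [Summit.QuantumFields.YangMills.Theorems.Prop7FlatHolonomy.transfUp_eq_embIter, Equiv.apply_symm_apply] at h1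
  have h := eq_one_of_axialGauge (k := K - n) U₀ U w hw' hU (fun x => by rw [gaugeActT_eq_gaugeAct]; exact hU' x)
  rw [h]
  funext b
  simp [GaugeField.gaugeAct]

/-- **CLAUSE 1 OF THE STUB AS UNIQUENESS OF A POINT IN THE SPACE (18)** ([Balaban1985Variational] p. 281: «we have reduced a proof of the existence and
the uniqueness of critical configurations in the space (18) …»): print's regular fibre (6)(ε₀) of `V` has at most one R2-critical (4)-orbit iff it contains
at most ONE comb-axial (relative to a fixed background `U₀`) R2-critical configuration. [cite: Balaban1985Variational, (18) p.280 and Prop. 2 p.281] -/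
theorem atMostOneCriticalOrbit_iff_unique_axial {ε₀ : ℝ} (V : GaugeField (F.P n) 0 (Matrix.specialUnitaryGroup (Fin 2) ℂ))
    (U₀ : GaugeField (F.P K) 0 (Matrix.specialUnitaryGroup (Fin 2) ℂ)) :
    (varProblem3 F n K h).AtMostOneCriticalOrbit ε₀ V ↔
      ∀ U U' : GaugeField (F.P K) 0 (Matrix.specialUnitaryGroup (Fin 2) ℂ),
        U ∈ regFibrePr F n K h ε₀ V → IsCritR2 F n K h V U →
        (∀ x, axialT U (embIter (K - n) (iterBlockOf (K - n) x)) x = axialT U₀ (embIter (K - n) (iterBlockOf (K - n) x)) x) →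
        U' ∈ regFibrePr F n K h ε₀ V → IsCritR2 F n K h V U' →
        (∀ x, axialT U' (embIter (K - n) (iterBlockOf (K - n) x)) x = axialT U₀ (embIter (K - n) (iterBlockOf (K - n) x)) x) →
        U = U' := by
  rw [atMostOneCriticalOrbit_iff_axial F h V U₀]
  constructor
  · intro H U U' hU hc hax hU' hc' hax'
    exact eq_of_sameOrbit_of_axial F h U₀ U U' hax hax' (H U U' hU hc hax hU' hc' hax')
  · intro H U U' hU hc hax hU' hc' hax'
    rw [H U U' hU hc hax hU' hc' hax']
    exact T3SectALandauChart.sameOrbit_refl F h U'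

end Summit.QuantumFields.YangMills.Theorems.Prop7AxialSpace18

end
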